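import Literature.Algebra.Homology.OrderedCech
import Mathlib.Algebra.Homology.HomologicalComplexAbelian
import Mathlib.Algebra.Homology.ShortComplex.ModuleCat
import HarnessLib

/-!
# Functoriality of the ordered Čech complex in the family of submodules; short exact sequences

`Literature/Algebra/Homology/OrderedCech` attaches to a monotone family `F : Finset ι → Submodule A 𝕂`
(all members inside one ambient `A`-module `𝕂`, e.g. the sections `Γ(U_s, 𝓕) ⊆ K(X)` of a subsheaf
of a constant sheaf on the intersections `U_s` of an affine cover) its ordered Čech complex
`OrderedCech.complex F hF : CochainComplex (ModuleCat A) ℤ` (Görtz–Wedhorn II, Def. 21.68; The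
Stacks Project, Tag 01FG). This file adds its functoriality in the family:

* `OrderedCech.Cochain.map ψ hψ n`, `OrderedCech.complexMap` — a linear map `ψ : 𝕂 → 𝕂'` with
  `ψ(F s) ⊆ G s` for all `s` induces a morphism of cochains commuting with the differential
  (`d_map`), hence a morphism of complexes `Č(F) → Č(G)` (a morphism of presheaves induces a morphism
  of Čech complexes, Stacks Project, Tag 01ED; Görtz–Wedhorn II, (21.14)–(21.15));
* `OrderedCech.familySC`, `OrderedCech.shortExact_familySC` — **a sequence of families which is
  short exact member by member gives a short exact sequence of Čech complexes**
  `0 → Č(E) → Č(F) → Č(G) → 0` (exactness of complexes of modules is checked degreewise, Mathlib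
  `HomologicalComplex.shortExact_of_degreewise_shortExact`; cf. Stacks Project, Tag 01EV: a short
  exact sequence of presheaves gives a short exact sequence of Čech complexes), the input of the
  long exact cohomology sequence (Mathlib `CategoryTheory.ShortComplex.ShortExact.δ`,
  `homology_exact₁/₂/₃`).

Everything is elementary bookkeeping and fully proved; it is used by
`Literature/Algebra/Homology/LaurentCechExact` (the short exact sequence of Čech complexes of a graded
presentation) on the way to Serre's finiteness theorem (`Literature/Algebra/Homology/SerreFiniteness`).
Mathlib searched (pin v4.32): `CategoryTheory/Sites/SheafCohomology/Cech` (abstract Čech complex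
functor of a presheaf, no module-level API), `HomologicalComplex.shortExact_of_degreewise_shortExact`,
`ModuleCat.shortComplex_shortExact`, `CochainComplex.ofHom` (used).

## References

* U. Görtz, T. Wedhorn, *Algebraic Geometry II: Cohomology of Schemes*, Springer Spektrum (2023),
  doi:10.1007/978-3-658-43031-3: (21.14)–(21.15), Def. 21.64, Def. 21.68 (pp. 258–260).
  [GortzWedhorn2023]
* The Stacks Project, Tags 01ED, 01EV, 01FG (Cohomology, Sections 20.9 and 20.23). [StacksProject]
-/

noncomputable section

universe u v

open CategoryTheory Finset

namespace Literature.Algebra.Homology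

namespace OrderedCech

variable {ι : Type} [LinearOrder ι] {A : Type u} [CommRing A]
variable {𝕂 : Type v} [AddCommGroup 𝕂] [Module A 𝕂] {𝕂' : Type v} [AddCommGroup 𝕂'] [Module A 𝕂']
variable {F : Finset ι → Submodule A 𝕂} {G : Finset ι → Submodule A 𝕂'}
variable (ψ : 𝕂 →ₗ[A] 𝕂') (hψ : ∀ s, ∀ x ∈ F s, ψ x ∈ G s)

/-- The map on cochains induced by a linear map `ψ : 𝕂 → 𝕂'` carrying `F s` into `G s` for every `s`
(e.g. the restriction maps of a morphism of (pre)sheaves, or an inclusion of families). [folklore] -/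
def Cochain.map (n : ℤ) : Cochain F n →ₗ[A] Cochain G n where
  toFun g σ := ⟨ψ (g σ : 𝕂), hψ σ.1 _ (g σ).2⟩
  map_add' g g' := by
    funext σ; apply Subtype.ext
    change ψ ((g σ : 𝕂) + (g' σ : 𝕂)) = ψ (g σ : 𝕂) + ψ (g' σ : 𝕂)
    rw [map_add]
  map_smul' a g := by
    funext σ; apply Subtype.ext
    change ψ (a • (g σ : 𝕂)) = a • ψ (g σ : 𝕂)
    rw [map_smul]

/-- The value of a mapped cochain. [folklore] -/
@[simp] theorem Cochain.coe_map_apply {n : ℤ} (g : Cochain F n) (σ : Simplex ι n) :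
    ((Cochain.map ψ hψ n g) σ : 𝕂') = ψ (g σ : 𝕂) := rfl

/-- Mapping commutes with extension by zero. [folklore] -/
theorem Cochain.ext0_map {n : ℤ} (g : Cochain F n) (s : Finset ι) :
    (Cochain.map ψ hψ n g).ext0 s = ψ (g.ext0 s) := by
  unfold Cochain.ext0
  split_ifs with h
  · rfl
  · rw [map_zero]

variable (hF : Monotone F) (hG : Monotone G)

/-- **Mapping commutes with the Čech differential.** [folklore] -/
theorem d_map {n : ℤ} (g : Cochain F n) :
    d G hG n (Cochain.map ψ hψ n g) = Cochain.map ψ hψ (n + 1) (d F hF n g) := by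
  funext σ
  apply Subtype.ext
  rw [coe_d_apply, Cochain.coe_map_apply, coe_d_apply, map_sum]
  refine Finset.sum_congr rfl fun a _ => ?_
  rw [Cochain.ext0_map, map_smul]

/-- **The morphism of ordered Čech complexes** induced by `ψ`. [folklore] -/
def complexMap : complex F hF ⟶ complex G hG :=
  CochainComplex.ofHom (fun n => ModuleCat.ofHom (Cochain.map ψ hψ n)) fun n => by
    rw [complex_d, complex_d]
    ext g
    exact d_map ψ hψ hF hG g

/-- The components of `complexMap`. [folklore] -/
@[simp] theorem complexMap_f (n : ℤ) :
    (complexMap ψ hψ hF hG).f n = ModuleCat.ofHom (Cochain.map ψ hψ n) := rfl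

/-- `Cochain.map` is injective in each degree as soon as `ψ` is injective on the members `F s`.
[folklore] -/
theorem Cochain.map_injective {n : ℤ} (hinj : ∀ s, ∀ x ∈ F s, ψ x = 0 → x = 0) :
    Function.Injective (Cochain.map ψ hψ n) := by
  intro g g' h
  rw [← sub_eq_zero] at h ⊢
  rw [← map_sub] at h
  funext σ
  apply Subtype.ext
  have := congr_arg (fun c : Cochain G n => (c σ : 𝕂')) h
  simp only [Cochain.coe_map_apply] at this
  exact hinj σ.1 _ ((g - g') σ).2 this

/-- `Cochain.map` is surjective in each degree as soon as `ψ` maps each `F s` onto `G s`. [folklore] -/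
theorem Cochain.map_surjective {n : ℤ} (hsurj : ∀ s, ∀ y ∈ G s, ∃ x ∈ F s, ψ x = y) :
    Function.Surjective (Cochain.map ψ hψ n) := by
  intro g
  choose x hx hψx using fun σ : Simplex ι n => hsurj σ.1 _ (g σ).2
  exact ⟨fun σ => ⟨x σ, hx σ⟩, funext fun σ => Subtype.ext (hψx σ)⟩

/-! ### Short exact sequences of ordered Čech complexes -/

variable {𝕂'' : Type v} [AddCommGroup 𝕂''] [Module A 𝕂''] {E : Finset ι → Submodule A 𝕂''} (hE : Monotone E)
variable (φ : 𝕂'' →ₗ[A] 𝕂) (hφ : ∀ s, ∀ x ∈ E s, φ x ∈ F s)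

/-- The short complex of ordered Čech complexes `Č(E) → Č(F) → Č(G)` attached to linear maps
`φ : 𝕂'' → 𝕂`, `ψ : 𝕂 → 𝕂'` compatible with the families and with `ψ ∘ φ = 0` on the members of `E`.
[folklore] -/
def familySC (hcomp : ∀ s, ∀ x ∈ E s, ψ (φ x) = 0) : ShortComplex (CochainComplex (ModuleCat.{v} A) ℤ) :=
  ShortComplex.mk (complexMap φ hφ hE hF) (complexMap ψ hψ hF hG) (by
    ext n g
    change Cochain.map ψ hψ n (Cochain.map φ hφ n g) = 0
    funext σ; apply Subtype.ext
    exact hcomp σ.1 _ (g σ).2)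

/-- The objects of `familySC` are the three ordered Čech complexes. [folklore] -/
@[simp] theorem familySC_X₁ (hcomp : ∀ s, ∀ x ∈ E s, ψ (φ x) = 0) :
    (familySC ψ hψ hF hG hE φ hφ hcomp).X₁ = complex E hE := rfl

/-- See `familySC_X₁`. [folklore] -/
@[simp] theorem familySC_X₂ (hcomp : ∀ s, ∀ x ∈ E s, ψ (φ x) = 0) :
    (familySC ψ hψ hF hG hE φ hφ hcomp).X₂ = complex F hF := rfl

/-- See `familySC_X₁`. [folklore] -/
@[simp] theorem familySC_X₃ (hcomp : ∀ s, ∀ x ∈ E s, ψ (φ x) = 0) :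
    (familySC ψ hψ hF hG hE φ hφ hcomp).X₃ = complex G hG := rfl

/-- The maps of `familySC`. [folklore] -/
@[simp] theorem familySC_f (hcomp : ∀ s, ∀ x ∈ E s, ψ (φ x) = 0) :
    (familySC ψ hψ hF hG hE φ hφ hcomp).f = complexMap φ hφ hE hF := rfl

/-- See `familySC_f`. [folklore] -/
@[simp] theorem familySC_g (hcomp : ∀ s, ∀ x ∈ E s, ψ (φ x) = 0) :
    (familySC ψ hψ hF hG hE φ hφ hcomp).g = complexMap ψ hψ hF hG := rfl

/-- **A short exact sequence of families gives a short exact sequence of ordered Čech complexes**: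
if, for every `s`, `φ` maps `E s` injectively into `F s`, `ψ` maps `F s` onto `G s`, and the
kernel of `ψ` on `F s` is the image of `E s`, then
`0 → Č(E) → Č(F) → Č(G) → 0` is a short exact sequence of cochain complexes (exactness is checked
degreewise, Mathlib `HomologicalComplex.shortExact_of_degreewise_shortExact`). [folklore] -/
theorem shortExact_familySC (hinj : ∀ s, ∀ x ∈ E s, φ x = 0 → x = 0)
    (hsurj : ∀ s, ∀ y ∈ G s, ∃ x ∈ F s, ψ x = y)
    (hcomp : ∀ s, ∀ x ∈ E s, ψ (φ x) = 0)
    (hex : ∀ s, ∀ x ∈ F s, ψ x = 0 → ∃ w ∈ E s, φ w = x) :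
    (familySC ψ hψ hF hG hE φ hφ hcomp).ShortExact := by
  apply HomologicalComplex.shortExact_of_degreewise_shortExact
  intro n
  apply ModuleCat.shortComplex_shortExact
  · -- exactness in the middle
    intro g
    constructor
    · intro hg
      change Cochain.map ψ hψ n g = 0 at hg
      choose w hw hφw using fun σ : Simplex ι n =>
        hex σ.1 _ (g σ).2 (by
          have := congr_arg (fun c : Cochain G n => (c σ : 𝕂')) hg
          exact this)
      refine ⟨fun σ => ⟨w σ, hw σ⟩, ?_⟩
      change Cochain.map φ hφ n _ = g
      exact funext fun σ => Subtype.ext (hφw σ)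
    · rintro ⟨g', rfl⟩
      change Cochain.map ψ hψ n (Cochain.map φ hφ n g') = 0
      funext σ; apply Subtype.ext
      exact hcomp σ.1 _ (g' σ).2
  · exact Cochain.map_injective φ hφ hinj
  · exact Cochain.map_surjective ψ hψ hsurj

end OrderedCech

end Literature.Algebra.Homology
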